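import Summits.CriticalPhenomena.PercolationContinuityZ3.Theorems.PercNearOneGluingNoHeavyLowerTailThreePointHalvingResample
import HarnessLib

/-!
# The four-point halving lemma (ii): resampling identity and the boundary relaxation (W_ii)
# (Sahi programme, prover prim-sahi-p2 gen 47)

Support file (`--supports stmt-CriticalPhenomena-4575`, helper).  No definitions, no named facts, no sorries; standard axioms.
Memo `run/shared/lean/prim/prim-sahi/FROM-prim-sahi-p2-gen47-RESAMPLING.md` §4; `prim-sahi-p2/PROOF-E3.md` §57.

SETTING.  `μ = prodBernoulli w` on a finite vertex type; four vertices `s, a, b, c`; `U = {s ↔ a} ∪ {c ↔ a}`,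
`E = {s ↔ b} ∩ {s ↮ c}`.  The FOUR-POINT HALVING LEMMA (ii) of memo gen 42 (§0(1); it implies (γ), hence the chord of C5 along
the `b–c` pairs, BCL-TT(b–c), gen 41 ADD. C) is `μ(U)·μ(E) ≤ 2·μ(U ∩ E)` — OPEN.  With `Ī = Uᶜ = {a ↮ s, a ↮ c}` the gap is
`μ(U)μ(E) − μ(U ∩ E) = μ(Ī ∩ E) − μ(Ī)μ(E)`.

WHAT IS PROVED HERE (finite sums `Σ_K wtW K …` with Gladkov's weights, as in `…ThreePointHalvingResample`).
* `reach_cohybrid_of_reach` — if every pair of `F` meets the open cluster of `a` in `K` and `a ↮ s` in `K`, every vertex joined to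
  `s` in `K` is joined to `s` in `splice F C K` (an `s`-walk of `K` never uses a pair meeting the cluster of `a`).
* **`sum_notU_inter_le`** — `μ(Ī ∩ E) ≤ μ(Ī)·μ(E) + Λ_ii` in finite-sum form, where
  `Λ_ii := Σ_K Σ_C wtW K · wtW C · 1[a ↮ s, a ↮ c, s ↔ b, s ↮ c in K ; C has a pair between C_a(K) and C_s(K) ; C has a pair
  between C_a(K) and C_c(K)]`: by the resampling identity (Gladkov's swap along the revealed set of the cluster of `a`,
  `DecisionTree.sum_pair_reindexW`) `μ(Ī)μ(E) = Σ_K Σ_C wtW K wtW C 1_Ī(K) 1_E(splice S(K) C K)`, and for `K ∈ Ī ∩ E` the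
  re-randomised configuration keeps `s ↔ b` (`reach_cohybrid_of_reach`), so it leaves `E` only if `s ↔ c` appears, which by the
  path lemma `HalvingResample.conn_cohybrid_meets` (at both ends) forces the two boundary events.
* **`halvingUE_of_boundaryResample`** — the REDUCTION: if `Λ_ii ≤ μ(U ∩ E)` (relaxation (W_ii) of the memo; numerically
  `Λ_ii ≤ 0.14·μ(U ∩ E)`) then `μ(U)·μ(E) ≤ 2·μ(U ∩ E)`.
Nothing here is conditional on an unproved fact: (W_ii) enters only as the hypothesis of the last theorem.
-/

noncomputable section

open Classical

namespace Summit.CriticalPhenomena.PercolationContinuityZ3.Theorems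

namespace HalvingResample

open Finset MeasureTheory
open Literature.Probability.Percolation Literature.Probability.Percolation.DecisionTree
open Literature.Probability.Percolation.TargetExploration Literature.Probability.Percolation.ClusterConditioning
open Literature.Probability.LatticeModels

variable {V : Type*} [Fintype V]

/-! ### Connections of `s` away from the cluster of `a` survive the re-randomisation -/

omit [Fintype V] in
/-- If every pair of `F` meets the open cluster of `a` in `K` and `a ↮ s` in `K`, then `s ↔ b` in `K` implies `s ↔ b` in
`splice F C K` (the configuration equal to `C` on `F` and to `K` off `F`): an `s`-walk of `K` uses no pair of `F`, since both
endpoints of its pairs are joined to `s`, not to `a`. [this work] -/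
theorem reach_cohybrid_of_reach {F K C : Finset (Sym2 V)} {a s b : V}
    (hF : ∀ e ∈ F, ∃ u ∈ e, (openGraph (↑K : Set (Sym2 V))).Reachable a u)
    (has : ¬ (openGraph (↑K : Set (Sym2 V))).Reachable a s)
    (hsb : (openGraph (↑K : Set (Sym2 V))).Reachable s b) :
    (openGraph (↑(splice F C K) : Set (Sym2 V))).Reachable s b := by
  -- every vertex of the walk is joined to `s` in `K`; induct along the walk
  suffices h : ∀ (x : V) (q : (openGraph (↑K : Set (Sym2 V))).Walk x b),
      (openGraph (↑K : Set (Sym2 V))).Reachable s x → (openGraph (↑(splice F C K) : Set (Sym2 V))).Reachable x b from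
    hsb.elim fun q => h s q (SimpleGraph.Reachable.refl s)
  clear hsb
  intro x q
  induction q with
  | nil => intro _; exact SimpleGraph.Reachable.refl _
  | @cons x y z hadj q ih =>
    intro hx
    have hy : (openGraph (↑K : Set (Sym2 V))).Reachable s y := hx.trans hadj.reachable
    have hadj' := hadj
    rw [openGraph_adj] at hadj'
    obtain ⟨hmem, hne⟩ := hadj'
    have hmemK : s(x, y) ∈ K := Finset.mem_coe.1 hmem
    have hnotF : s(x, y) ∉ F := by
      intro heF
      obtain ⟨u, hu, hau⟩ := hF _ heF
      rcases Sym2.mem_iff.1 hu with rfl | rfl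
      · exact has (hau.trans hx.symm)
      · exact has (hau.trans hy.symm)
    have hadjθ : (openGraph (↑(splice F C K) : Set (Sym2 V))).Adj x y := by
      rw [openGraph_adj]
      exact ⟨Finset.mem_coe.2 ((mem_splice_of_not_mem hnotF).2 hmemK), hne⟩
    exact hadjθ.reachable.trans (ih hy)

/-! ### The resampling bound for the four-point gap -/

/-- **`μ(Ī ∩ E) ≤ μ(Ī)·μ(E) + Λ_ii`** in finite-sum form (`Ī = {a ↮ s, a ↮ c}`, `E = {s ↔ b, s ↮ c}`): Gladkov's swap along the
revealed set of the cluster exploration of `a` turns `μ(Ī)μ(E)` into `Σ_K Σ_C wtW K wtW C 1_Ī(K) 1_E(splice S(K) C K)`; on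
`K ∈ Ī ∩ E` the spliced configuration keeps `s ↔ b` and can only leave `E` by creating `s ↔ c`, which needs a pair of `C` between
`C_a(K)` and `C_s(K)` and one between `C_a(K)` and `C_c(K)` (`conn_cohybrid_meets`). [this work] -/
theorem sum_notU_inter_le {p : Sym2 V → ℝ} (hp0 : ∀ e, 0 ≤ p e) (hp1 : ∀ e, p e ≤ 1) (s a b c : V) :
    ∑ K ∈ (Finset.univ : Finset (Sym2 V)).powerset, wtW Finset.univ p K *
        ind {K : Finset (Sym2 V) | (¬ (openGraph (↑K : Set (Sym2 V))).Reachable a s ∧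
            ¬ (openGraph (↑K : Set (Sym2 V))).Reachable a c) ∧
          ((openGraph (↑K : Set (Sym2 V))).Reachable s b ∧ ¬ (openGraph (↑K : Set (Sym2 V))).Reachable s c)} K ≤
    (∑ K ∈ (Finset.univ : Finset (Sym2 V)).powerset, wtW Finset.univ p K *
        ind {K : Finset (Sym2 V) | ¬ (openGraph (↑K : Set (Sym2 V))).Reachable a s ∧
          ¬ (openGraph (↑K : Set (Sym2 V))).Reachable a c} K) *
      (∑ C ∈ (Finset.univ : Finset (Sym2 V)).powerset, wtW Finset.univ p C *
        ind {C : Finset (Sym2 V) | (openGraph (↑C : Set (Sym2 V))).Reachable s b ∧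
          ¬ (openGraph (↑C : Set (Sym2 V))).Reachable s c} C) +
    ∑ K ∈ (Finset.univ : Finset (Sym2 V)).powerset, ∑ C ∈ (Finset.univ : Finset (Sym2 V)).powerset,
      wtW Finset.univ p K * wtW Finset.univ p C *
        ind {x : Finset (Sym2 V) × Finset (Sym2 V) |
            (¬ (openGraph (↑x.1 : Set (Sym2 V))).Reachable a s ∧ ¬ (openGraph (↑x.1 : Set (Sym2 V))).Reachable a c ∧
                (openGraph (↑x.1 : Set (Sym2 V))).Reachable s b ∧ ¬ (openGraph (↑x.1 : Set (Sym2 V))).Reachable s c) ∧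
              (∃ e ∈ x.2, ∃ u v : V, e = s(u, v) ∧ (openGraph (↑x.1 : Set (Sym2 V))).Reachable a u ∧
                (openGraph (↑x.1 : Set (Sym2 V))).Reachable s v) ∧
              (∃ e ∈ x.2, ∃ u v : V, e = s(u, v) ∧ (openGraph (↑x.1 : Set (Sym2 V))).Reachable a u ∧
                (openGraph (↑x.1 : Set (Sym2 V))).Reachable c v)} (K, C) := by
  set D : Finset (Sym2 V) := Finset.univ with hD
  set Ib : Set (Finset (Sym2 V)) := {K | ¬ (openGraph (↑K : Set (Sym2 V))).Reachable a s ∧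
      ¬ (openGraph (↑K : Set (Sym2 V))).Reachable a c} with hIb
  set Ev : Set (Finset (Sym2 V)) := {C | (openGraph (↑C : Set (Sym2 V))).Reachable s b ∧
      ¬ (openGraph (↑C : Set (Sym2 V))).Reachable s c} with hEv
  set J : Set (Finset (Sym2 V)) := {K | (¬ (openGraph (↑K : Set (Sym2 V))).Reachable a s ∧
      ¬ (openGraph (↑K : Set (Sym2 V))).Reachable a c) ∧
      ((openGraph (↑K : Set (Sym2 V))).Reachable s b ∧ ¬ (openGraph (↑K : Set (Sym2 V))).Reachable s c)} with hJ
  set Lam : Set (Finset (Sym2 V) × Finset (Sym2 V)) := {x |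
      (¬ (openGraph (↑x.1 : Set (Sym2 V))).Reachable a s ∧ ¬ (openGraph (↑x.1 : Set (Sym2 V))).Reachable a c ∧
          (openGraph (↑x.1 : Set (Sym2 V))).Reachable s b ∧ ¬ (openGraph (↑x.1 : Set (Sym2 V))).Reachable s c) ∧
        (∃ e ∈ x.2, ∃ u v : V, e = s(u, v) ∧ (openGraph (↑x.1 : Set (Sym2 V))).Reachable a u ∧
          (openGraph (↑x.1 : Set (Sym2 V))).Reachable s v) ∧
        (∃ e ∈ x.2, ∃ u v : V, e = s(u, v) ∧ (openGraph (↑x.1 : Set (Sym2 V))).Reachable a u ∧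
          (openGraph (↑x.1 : Set (Sym2 V))).Reachable c v)} with hLam
  -- the resampling identity for `1_Ī(K)·1_E(C)`
  have hF := selfDetermined_revealedAt (D := D) (A := (∅ : Finset V)) (o := a)
  have hre := sum_pair_reindexW D p hF (fun x => ind Ib x.1 * ind Ev x.2)
  have hprod : (∑ K ∈ D.powerset, wtW D p K * ind Ib K) * (∑ C ∈ D.powerset, wtW D p C * ind Ev C) =
      ∑ K ∈ D.powerset, ∑ C ∈ D.powerset, wtW D p K * wtW D p C *
        (ind Ib K * ind Ev (splice (revealedAt D (∅ : Finset V) a K) C K)) := by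
    rw [Finset.sum_mul_sum, ← Finset.sum_product']
    have hl : ∑ x ∈ D.powerset ×ˢ D.powerset, wtW D p x.1 * ind Ib x.1 * (wtW D p x.2 * ind Ev x.2) =
        ∑ x ∈ D.powerset ×ˢ D.powerset, wt2W D p x * (ind Ib x.1 * ind Ev x.2) := by
      refine Finset.sum_congr rfl fun x _ => ?_
      simp only [wt2W]; ring
    rw [hl, hre, Finset.sum_product]
    refine Finset.sum_congr rfl fun K _ => Finset.sum_congr rfl fun C _ => ?_
    have h1 : ind Ib (swapPair (revealedAt D (∅ : Finset V) a) (K, C)).1 = ind Ib K := by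
      have hiff : (swapPair (revealedAt D (∅ : Finset V) a) (K, C)).1 ∈ Ib ↔ K ∈ Ib := by
        simp only [swapPair, hIb, Set.mem_setOf_eq, hD, reachable_hybrid_iff]
      by_cases hK : K ∈ Ib
      · rw [ind_of_mem hK, ind_of_mem (hiff.2 hK)]
      · rw [ind_of_not_mem hK, ind_of_not_mem (fun h => hK (hiff.1 h))]
    have h2 : (swapPair (revealedAt D (∅ : Finset V) a) (K, C)).2 = splice (revealedAt D (∅ : Finset V) a K) C K := rfl
    simp only [wt2W, h1, h2]
  -- `μ(Ī ∩ E)` as a double sum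
  have hone : ∑ C ∈ D.powerset, wtW D p C = 1 := sum_wtW D p
  have hJsum : ∑ K ∈ D.powerset, wtW D p K * ind J K =
      ∑ K ∈ D.powerset, ∑ C ∈ D.powerset, wtW D p K * wtW D p C * ind J K := by
    refine Finset.sum_congr rfl fun K _ => ?_
    have : ∑ C ∈ D.powerset, wtW D p K * wtW D p C * ind J K = (wtW D p K * ind J K) * ∑ C ∈ D.powerset, wtW D p C := by
      rw [Finset.mul_sum]
      refine Finset.sum_congr rfl fun C _ => ?_
      ring
    rw [this, hone, mul_one]
  -- pointwise bound
  have hpt : ∀ K C : Finset (Sym2 V),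
      ind J K ≤ ind Ib K * ind Ev (splice (revealedAt D (∅ : Finset V) a K) C K) + ind Lam (K, C) := by
    intro K C
    have hL0 : 0 ≤ ind Lam (K, C) := by unfold ind; split_ifs <;> norm_num
    have hE0 : 0 ≤ ind Ev (splice (revealedAt D (∅ : Finset V) a K) C K) := by unfold ind; split_ifs <;> norm_num
    have hI0 : 0 ≤ ind Ib K := by unfold ind; split_ifs <;> norm_num
    by_cases hK : K ∈ J
    · rw [ind_of_mem hK]
      have hKI : K ∈ Ib := hK.1
      rw [ind_of_mem hKI, one_mul]
      by_cases hθ : splice (revealedAt D (∅ : Finset V) a K) C K ∈ Ev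
      · rw [ind_of_mem hθ]; linarith
      · -- `s ↔ b` survives, so `s ↔ c` appeared: path lemma at both ends
        have hFa : ∀ e ∈ revealedAt D (∅ : Finset V) a K, ∃ u ∈ e, (openGraph (↑K : Set (Sym2 V))).Reachable a u :=
          fun e he => by rw [hD] at he; exact exists_reachable_of_mem_revealedAt he
        have hsb : (openGraph (↑(splice (revealedAt D (∅ : Finset V) a K) C K) : Set (Sym2 V))).Reachable s b :=
          reach_cohybrid_of_reach hFa hK.1.1 hK.2.1
        have hsc : (openGraph (↑(splice (revealedAt D (∅ : Finset V) a K) C K) : Set (Sym2 V))).Reachable s c := by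
          by_contra hnot
          exact hθ ⟨hsb, hnot⟩
        obtain ⟨e1, he1, u1, v1, he1', hau1, hsv1⟩ := conn_cohybrid_meets hFa hK.1.1 hK.2.2 hsc
        obtain ⟨e2, he2, u2, v2, he2', hau2, hcv2⟩ :=
          conn_cohybrid_meets hFa hK.1.2 (fun h => hK.2.2 h.symm) hsc.symm
        have hmem : (K, C) ∈ Lam :=
          ⟨⟨hK.1.1, hK.1.2, hK.2.1, hK.2.2⟩, ⟨e1, he1, u1, v1, he1', hau1, hsv1⟩, ⟨e2, he2, u2, v2, he2', hau2, hcv2⟩⟩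
        rw [ind_of_mem hmem, ind_of_not_mem hθ]; linarith
    · rw [ind_of_not_mem hK]
      nlinarith
  -- sum it up
  have hw0 : ∀ K : Finset (Sym2 V), 0 ≤ wtW D p K := fun K => wtW_nonneg D hp0 hp1 K
  rw [hJsum, hprod, ← Finset.sum_add_distrib]
  refine Finset.sum_le_sum fun K _ => ?_
  rw [← Finset.sum_add_distrib]
  refine Finset.sum_le_sum fun C _ => ?_
  have := mul_le_mul_of_nonneg_left (hpt K C) (mul_nonneg (hw0 K) (hw0 C))
  linarith [this]

/-! ### The reduction: (W_ii) ⟹ the four-point halving lemma (ii) -/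

/-- **The four-point halving lemma from the boundary relaxation (W_ii).**  `μ = prodBernoulli w`, `U = {s↔a} ∪ {c↔a}`,
`E = {s↔b} ∩ {s↮c}`.  If `Λ_ii := Σ_K Σ_C wtW K · wtW C · 1[a↮s, a↮c, s↔b, s↮c in K ; C has a pair between C_a(K) and C_s(K) ;
C has a pair between C_a(K) and C_c(K)] ≤ μ(U ∩ E)`, then `μ(U)·μ(E) ≤ 2·μ(U ∩ E)` (the lemma (ii) of memo gen 42, open in general).
Proof: `μ(U)μ(E) − 2μ(U∩E) = [μ(Ī∩E) − μ(Ī)μ(E)] − μ(U∩E) ≤ Λ_ii − μ(U∩E) ≤ 0` by `sum_notU_inter_le`. [this work] -/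
theorem halvingUE_of_boundaryResample (w : Sym2 V → unitInterval) (s a b c : V)
    (hW : ∑ K ∈ (Finset.univ : Finset (Sym2 V)).powerset, ∑ C ∈ (Finset.univ : Finset (Sym2 V)).powerset,
        wtW Finset.univ (fun e => (w e : ℝ)) K * wtW Finset.univ (fun e => (w e : ℝ)) C *
          ind {x : Finset (Sym2 V) × Finset (Sym2 V) |
              (¬ (openGraph (↑x.1 : Set (Sym2 V))).Reachable a s ∧ ¬ (openGraph (↑x.1 : Set (Sym2 V))).Reachable a c ∧
                  (openGraph (↑x.1 : Set (Sym2 V))).Reachable s b ∧ ¬ (openGraph (↑x.1 : Set (Sym2 V))).Reachable s c) ∧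
                (∃ e ∈ x.2, ∃ u v : V, e = s(u, v) ∧ (openGraph (↑x.1 : Set (Sym2 V))).Reachable a u ∧
                  (openGraph (↑x.1 : Set (Sym2 V))).Reachable s v) ∧
                (∃ e ∈ x.2, ∃ u v : V, e = s(u, v) ∧ (openGraph (↑x.1 : Set (Sym2 V))).Reachable a u ∧
                  (openGraph (↑x.1 : Set (Sym2 V))).Reachable c v)} (K, C) ≤
      (prodBernoulli w).real ((openConn s a ∪ openConn c a) ∩ (openConn s b ∩ (openConn s c)ᶜ))) :
    (prodBernoulli w).real (openConn s a ∪ openConn c a) * (prodBernoulli w).real (openConn s b ∩ (openConn s c)ᶜ) ≤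
      2 * (prodBernoulli w).real ((openConn s a ∪ openConn c a) ∩ (openConn s b ∩ (openConn s c)ᶜ)) := by
  set D : Finset (Sym2 V) := Finset.univ with hD
  set p : Sym2 V → ℝ := fun e => (w e : ℝ) with hp
  have hp0 : ∀ e, 0 ≤ p e := fun e => (w e).2.1
  have hp1 : ∀ e, p e ≤ 1 := fun e => (w e).2.2
  have hdet : ∀ X : Set (BondConfig V), DeterminedBy X (↑D : Set (Sym2 V)) := by
    intro X
    rw [determinedBy_iff]
    intro ω ω' h
    rw [hD, Finset.coe_univ, Set.inter_univ, Set.inter_univ] at h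
    rw [h]
  set U : Set (BondConfig V) := openConn s a ∪ openConn c a with hU
  set Ev' : Set (BondConfig V) := openConn s b ∩ (openConn s c)ᶜ with hEv'
  have eU : (prodBernoulli w).real U = ∑ K ∈ D.powerset, wtW D p K * ind {K : Finset (Sym2 V) | (↑K : Set (Sym2 V)) ∈ U} K := by
    rw [DecisionTree.prodBernoulli_real_eq_PrW w (hdet U) (X := {K : Finset (Sym2 V) | (↑K : Set (Sym2 V)) ∈ U})
      (fun S _ => Iff.rfl), PrW_eq_sum_ind]
  have eE : (prodBernoulli w).real Ev' = ∑ K ∈ D.powerset, wtW D p K * ind {K : Finset (Sym2 V) | (↑K : Set (Sym2 V)) ∈ Ev'} K := by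
    rw [DecisionTree.prodBernoulli_real_eq_PrW w (hdet Ev') (X := {K : Finset (Sym2 V) | (↑K : Set (Sym2 V)) ∈ Ev'})
      (fun S _ => Iff.rfl), PrW_eq_sum_ind]
  have eX : (prodBernoulli w).real (U ∩ Ev') =
      ∑ K ∈ D.powerset, wtW D p K * ind {K : Finset (Sym2 V) | (↑K : Set (Sym2 V)) ∈ U ∩ Ev'} K := by
    rw [DecisionTree.prodBernoulli_real_eq_PrW w (hdet (U ∩ Ev')) (X := {K : Finset (Sym2 V) | (↑K : Set (Sym2 V)) ∈ U ∩ Ev'})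
      (fun S _ => Iff.rfl), PrW_eq_sum_ind]
  set Ib : Set (Finset (Sym2 V)) := {K | ¬ (openGraph (↑K : Set (Sym2 V))).Reachable a s ∧
      ¬ (openGraph (↑K : Set (Sym2 V))).Reachable a c} with hIb
  set Ev : Set (Finset (Sym2 V)) := {C | (openGraph (↑C : Set (Sym2 V))).Reachable s b ∧
      ¬ (openGraph (↑C : Set (Sym2 V))).Reachable s c} with hEv
  set J : Set (Finset (Sym2 V)) := {K | (¬ (openGraph (↑K : Set (Sym2 V))).Reachable a s ∧
      ¬ (openGraph (↑K : Set (Sym2 V))).Reachable a c) ∧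
      ((openGraph (↑K : Set (Sym2 V))).Reachable s b ∧ ¬ (openGraph (↑K : Set (Sym2 V))).Reachable s c)} with hJ
  have hmemU : ∀ K : Finset (Sym2 V), K ∈ {K : Finset (Sym2 V) | (↑K : Set (Sym2 V)) ∈ U} ↔ K ∉ Ib := by
    intro K
    simp only [hU, hIb, Set.mem_setOf_eq, Set.mem_union, openConn, not_and_or, not_not]
    constructor
    · rintro (h | h)
      · exact Or.inl h.symm
      · exact Or.inr h.symm
    · rintro (h | h)
      · exact Or.inl h.symm
      · exact Or.inr h.symm
  have hmemE : ∀ K : Finset (Sym2 V), K ∈ {K : Finset (Sym2 V) | (↑K : Set (Sym2 V)) ∈ Ev'} ↔ K ∈ Ev := by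
    intro K
    simp only [hEv', hEv, Set.mem_setOf_eq, Set.mem_inter_iff, Set.mem_compl_iff, openConn]
  have hmemX : ∀ K : Finset (Sym2 V), K ∈ {K : Finset (Sym2 V) | (↑K : Set (Sym2 V)) ∈ U ∩ Ev'} ↔ K ∉ Ib ∧ K ∈ Ev := by
    intro K
    rw [← hmemU K, ← hmemE K]
    simp only [Set.mem_setOf_eq, Set.mem_inter_iff]
  have hJ' : ∀ K : Finset (Sym2 V), K ∈ J ↔ K ∈ Ib ∧ K ∈ Ev := fun K => by simp only [hJ, hIb, hEv, Set.mem_setOf_eq]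
  have pU : ∀ K, ind {K : Finset (Sym2 V) | (↑K : Set (Sym2 V)) ∈ U} K = 1 - ind Ib K := by
    intro K
    by_cases hK : K ∈ Ib
    · rw [ind_of_mem hK, ind_of_not_mem (fun h => (hmemU K).1 h hK)]; ring
    · rw [ind_of_not_mem hK, ind_of_mem ((hmemU K).2 hK)]; ring
  have pE : ∀ K, ind {K : Finset (Sym2 V) | (↑K : Set (Sym2 V)) ∈ Ev'} K = ind Ev K := by
    intro K
    by_cases hK : K ∈ Ev
    · rw [ind_of_mem hK, ind_of_mem ((hmemE K).2 hK)]
    · rw [ind_of_not_mem hK, ind_of_not_mem (fun h => hK ((hmemE K).1 h))]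
  have pX : ∀ K, ind {K : Finset (Sym2 V) | (↑K : Set (Sym2 V)) ∈ U ∩ Ev'} K = ind Ev K - ind J K := by
    intro K
    by_cases hK : K ∈ Ib <;> by_cases hK' : K ∈ Ev
    · rw [ind_of_mem hK', ind_of_mem ((hJ' K).2 ⟨hK, hK'⟩), ind_of_not_mem (fun h => ((hmemX K).1 h).1 hK)]; ring
    · rw [ind_of_not_mem hK', ind_of_not_mem (fun h => hK' ((hJ' K).1 h).2),
        ind_of_not_mem (fun h => hK' ((hmemX K).1 h).2)]; ring
    · rw [ind_of_mem hK', ind_of_not_mem (fun h => hK ((hJ' K).1 h).1), ind_of_mem ((hmemX K).2 ⟨hK, hK'⟩)]; ring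
    · rw [ind_of_not_mem hK', ind_of_not_mem (fun h => hK ((hJ' K).1 h).1),
        ind_of_not_mem (fun h => hK' ((hmemX K).1 h).2)]; ring
  have hone : ∑ K ∈ D.powerset, wtW D p K = 1 := sum_wtW D p
  set Iv := ∑ K ∈ D.powerset, wtW D p K * ind Ib K with hIv
  set ev := ∑ K ∈ D.powerset, wtW D p K * ind Ev K with hev
  set jv := ∑ K ∈ D.powerset, wtW D p K * ind J K with hjv
  have sU : (prodBernoulli w).real U = 1 - Iv := by
    rw [eU, hIv, ← hone, ← Finset.sum_sub_distrib]
    refine Finset.sum_congr rfl fun K _ => ?_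
    rw [pU]; ring
  have sE : (prodBernoulli w).real Ev' = ev := by
    rw [eE, hev]
    refine Finset.sum_congr rfl fun K _ => ?_
    rw [pE]
  have sX : (prodBernoulli w).real (U ∩ Ev') = ev - jv := by
    rw [eX, hev, hjv, ← Finset.sum_sub_distrib]
    refine Finset.sum_congr rfl fun K _ => ?_
    rw [pX]; ring
  have key := sum_notU_inter_le hp0 hp1 s a b c
  rw [← hIv, ← hev, ← hjv] at key
  have hev0 : 0 ≤ ev := by
    rw [hev]; exact Finset.sum_nonneg fun K _ => mul_nonneg (wtW_nonneg D hp0 hp1 K) (by unfold ind; split_ifs <;> norm_num)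
  have hIv0 : 0 ≤ Iv := by
    rw [hIv]; exact Finset.sum_nonneg fun K _ => mul_nonneg (wtW_nonneg D hp0 hp1 K) (by unfold ind; split_ifs <;> norm_num)
  rw [sX] at hW
  rw [sU, sE, sX]
  nlinarith [key, hW, hev0, hIv0]

end HalvingResample

end Summit.CriticalPhenomena.PercolationContinuityZ3.Theorems
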